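import Summits.MatrixMultiplication.MatrixMultiplication.Theorems.OutsiderSandwichPencilLaw

/-!
# Outsider sandwich — the pencil law is SHARP: coordinate slices and product pencils (K38-2f)

decomp-mm lens-4, generation 38, Part IIf (helper toward `LaserTangency`, stmt-32268; theses-free,
definition-free).  Part IId proved the pencil law for the diagonalised Coppersmith–Winograd tensor
`D^{⊠N}` (`D a b c = [a,b,c pairwise distinct]`, `D ≅ cw₂` over `ℂ`): every `≥ 3`-dimensional space
of covectors contains a slice of rank `≥ (3/2)·2^N`.  This file shows the constant `3/2` and the
single-slice floor `2^N` are attained for every `N`: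

* `slice_succ_prod` — for a PRODUCT covector `η = ζ ⊗ ε` (`η_d = ζ_d · ε`),
  `T_{N+1}(η)(g,h) = D_ζ(g₀,h₀) · T_N(ε)(tail g, tail h)` with `D_ζ(i,j) = Σ_d ζ_d D(d,i,j)`
  (a Kronecker product `D_ζ ⊗ T_N(ε)`);
* `rank_blockRow_le`, `eq_sum_blockRows`, `rank_sum_le` — a Kronecker product with a `3 × 3` factor
  is the sum of its three block-rows, each of rank `≤ rank T_N(ε)`;
* `rank_slice_single_le` / `rank_slice_single` — every COORDINATE slice `T_N(e_w)` has rank exactly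
  `2^N` (the floor `two_pow_le_rank_slice` of Part IIb is attained);
* `pencil_law_sharp` — the `3`-space `ℂ³ ⊗ e_{0^N}` has all slices of rank `≤ 3·2^N = (3/2)·2^{N+1}`;
  with Part IId: `min over 3-spaces U of max_{η ∈ U} rank T_{N+1}(η)` is exactly `(3/2)·2^{N+1}`
  (`pencil_constant`).

Consequently the pencil slack law of Part IIe (`3·2^N + 4·F·m² ≤ 2m + 4·3^N`) is the best inequality
the 3-space transport can give; improving the census further needs pencils of dimension `≥ 7`
(numerically `(9/4)·2^N` at `N = 2`) or a non-slice invariant.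

References.
* D. Coppersmith, S. Winograd, *Matrix multiplication via arithmetic progressions*,
  J. Symbolic Comput. 9 (1990) 251–280, §6. [CoppersmithWinograd1990]
* M. Bläser, C. Ikenmeyer, V. Lysikov, A. Pandey, F.-O. Schreyer, *Variety membership testing,
  algebraic natural proofs, and geometric complexity theory*, arXiv:1911.02534, Def. 13 (minrank).
  [BlaserIkenmeyerLysikovPandeySchreyer2019]
* R. A. Horn, C. R. Johnson, *Matrix Analysis*, 2nd ed., CUP 2013, §0.4.5, §4.2 (rank of sums and
  Kronecker products). [HornJohnson2013]
-/

set_option linter.dupNamespace false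

namespace Summit.MatrixMultiplication.MatrixMultiplication.Theorems.OutsiderSandwichPencilSharp

open Literature.Computability.AlgebraicComplexity
open OutsiderSandwichPencilBlocks OutsiderSandwichPencilLaw
open scoped Matrix

variable {D : Fin 3 → Fin 3 → Fin 3 → ℂ}

/-! ## 1. Product covectors give Kronecker slices -/

/-- For a product covector (`η_d = ζ_d • ε` for every first letter `d`),
`T_{N+1}(η)(g,h) = (Σ_d ζ_d D(d,g₀,h₀)) · T_N(ε)(tail g, tail h)`. [folklore] -/
theorem slice_succ_prod (N : ℕ) (η : (Fin (N + 1) → Fin 3) → ℂ) (ζ : Fin 3 → ℂ)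
    (ε : (Fin N → Fin 3) → ℂ)
    (hη : ∀ d, (fun v : Fin N → Fin 3 => η (Fin.cons d v)) = ζ d • ε)
    (g h : Fin (N + 1) → Fin 3) :
    contract3 (kroneckerPow D (N + 1)) η g h =
      (∑ d, ζ d * D d (g 0) (h 0)) * contract3 (kroneckerPow D N) ε (Fin.tail g) (Fin.tail h) := by
  conv_lhs => rw [← Fin.cons_self_tail g, ← Fin.cons_self_tail h]
  rw [slice_succ_split, Finset.sum_mul]
  refine Finset.sum_congr rfl fun d _ => ?_
  rw [hη d, slice_smul, Matrix.smul_apply, smul_eq_mul]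
  ring

/-! ## 2. Block rows of a Kronecker product with a `3 × 3` factor -/

/-- One block-row `{g : g₀ = i}` of the Kronecker matrix `(g,h) ↦ Dz(g₀,h₀)·X(tail g, tail h)` has rank
`≤ rank X`: it factors as `A · X · B`. [cite: HornJohnson2013, §0.4.5] -/
theorem rank_blockRow_le (N : ℕ) (Dz : Fin 3 → Fin 3 → ℂ)
    (X : Matrix (Fin N → Fin 3) (Fin N → Fin 3) ℂ) (i : Fin 3) :
    (Matrix.of fun g h : Fin (N + 1) → Fin 3 =>
      if g 0 = i then Dz (g 0) (h 0) * X (Fin.tail g) (Fin.tail h) else 0).rank ≤ X.rank := by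
  classical
  let A : Matrix (Fin (N + 1) → Fin 3) (Fin N → Fin 3) ℂ :=
    Matrix.of fun g u => if g 0 = i ∧ Fin.tail g = u then 1 else 0
  let B : Matrix (Fin N → Fin 3) (Fin (N + 1) → Fin 3) ℂ :=
    Matrix.of fun v h => if Fin.tail h = v then Dz i (h 0) else 0
  have hAX : ∀ g v, (A * X) g v = if g 0 = i then X (Fin.tail g) v else 0 := by
    intro g v
    rw [Matrix.mul_apply]
    by_cases hg : g 0 = i
    · rw [if_pos hg, Finset.sum_eq_single (Fin.tail g)]
      · simp [A, hg]
      · intro u _ hu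
        simp [A, Ne.symm hu]
      · simp
    · rw [if_neg hg]
      exact Finset.sum_eq_zero fun u _ => by simp [A, hg]
  have hfac : (Matrix.of fun g h : Fin (N + 1) → Fin 3 =>
      if g 0 = i then Dz (g 0) (h 0) * X (Fin.tail g) (Fin.tail h) else 0) = A * X * B := by
    ext g h
    rw [Matrix.mul_apply, Matrix.of_apply]
    simp_rw [hAX]
    by_cases hg : g 0 = i
    · simp_rw [if_pos hg]
      rw [Finset.sum_eq_single (Fin.tail h)]
      · simp [B, hg, mul_comm]
      · intro v _ hv
        simp [B, Ne.symm hv]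
      · simp
    · simp_rw [if_neg hg]
      simp
  rw [hfac]
  exact (Matrix.rank_mul_le_left _ _).trans (Matrix.rank_mul_le_right _ _)

/-- A Kronecker matrix with a `3 × 3` first factor is the sum of its three block-rows. [folklore] -/
theorem eq_sum_blockRows (N : ℕ) (Dz : Fin 3 → Fin 3 → ℂ)
    (X : Matrix (Fin N → Fin 3) (Fin N → Fin 3) ℂ)
    (M : Matrix (Fin (N + 1) → Fin 3) (Fin (N + 1) → Fin 3) ℂ)
    (hM : ∀ g h, M g h = Dz (g 0) (h 0) * X (Fin.tail g) (Fin.tail h)) :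
    M = ∑ i : Fin 3, Matrix.of fun g h : Fin (N + 1) → Fin 3 =>
      if g 0 = i then Dz (g 0) (h 0) * X (Fin.tail g) (Fin.tail h) else 0 := by
  ext g h
  rw [hM, Matrix.sum_apply, Finset.sum_eq_single (g 0)]
  · simp
  · intro i _ hi
    simp [Ne.symm hi]
  · simp

/-- Rank is subadditive over finite sums of matrices. [cite: HornJohnson2013, §0.4.5] -/
theorem rank_sum_le {m n α : Type*} [Fintype m] [Fintype n] (s : Finset α) (f : α → Matrix m n ℂ) :
    (∑ i ∈ s, f i).rank ≤ ∑ i ∈ s, (f i).rank := by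
  classical
  induction s using Finset.induction_on with
  | empty => simp
  | @insert a s ha ih =>
    rw [Finset.sum_insert ha, Finset.sum_insert ha]
    exact (Literature.Barriers.Schanuel.rank_add_le_rank_add_rank _ _).trans
      (Nat.add_le_add_left ih _)

/-! ## 3. Coordinate slices have rank exactly `2^N` -/

/-- Every coordinate slice `T_N(e_w)` of `D^{⊠N}` has rank `≤ 2^N` (its block-rows halve at each letter:
the row `w₀` of `D(w₀,·,·)` vanishes). [cite: CoppersmithWinograd1990, §6] -/
theorem rank_slice_single_le (hD : ∀ a b c, D a b c = if a ≠ b ∧ b ≠ c ∧ a ≠ c then 1 else 0) :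
    ∀ (N : ℕ) (w : Fin N → Fin 3),
      (contract3 (kroneckerPow D N) (fun v => if v = w then (1 : ℂ) else 0)).rank ≤ 2 ^ N := by
  intro N
  induction N with
  | zero =>
    intro w
    refine (Matrix.rank_le_card_width _).trans ?_
    simp
  | succ N ih =>
    intro w
    classical
    set η : (Fin (N + 1) → Fin 3) → ℂ := fun v => if v = w then 1 else 0 with hη
    have hcomp : ∀ d, (fun v : Fin N → Fin 3 => η (Fin.cons d v)) =
        (if d = w 0 then (1 : ℂ) else 0) •
          (fun v : Fin N → Fin 3 => if v = Fin.tail w then (1 : ℂ) else 0) := by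
      intro d
      funext v
      by_cases h1 : d = w 0
      · by_cases h2 : v = Fin.tail w
        · simp [hη, h1, h2]
        · have hcw : (Fin.cons d v : Fin (N + 1) → Fin 3) ≠ w := fun h =>
            h2 (by rw [← h, Fin.tail_cons])
          simp [hη, hcw, h2]
      · have hcw : (Fin.cons d v : Fin (N + 1) → Fin 3) ≠ w := fun h =>
          h1 (by rw [← h, Fin.cons_zero])
        simp [hη, hcw, h1]
    have hX := ih (Fin.tail w)
    set X := contract3 (kroneckerPow D N) (fun v => if v = Fin.tail w then (1 : ℂ) else 0) with hXd
    have hM : ∀ g h, contract3 (kroneckerPow D (N + 1)) η g h =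
        D (w 0) (g 0) (h 0) * X (Fin.tail g) (Fin.tail h) := by
      intro g h
      rw [slice_succ_prod N η _ _ hcomp g h]
      congr 1
      rw [Finset.sum_eq_single (w 0)]
      · simp
      · intro d _ hd
        simp [hd]
      · simp
    rw [eq_sum_blockRows N (D (w 0)) X _ hM]
    refine (rank_sum_le _ _).trans ?_
    rw [← Finset.add_sum_erase _ _ (Finset.mem_univ (w 0))]
    have hzero : (Matrix.of fun g h : Fin (N + 1) → Fin 3 =>
        if g 0 = w 0 then D (w 0) (g 0) (h 0) * X (Fin.tail g) (Fin.tail h) else 0) = 0 := by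
      ext g h
      simp only [Matrix.of_apply, Matrix.zero_apply]
      split_ifs with hg
      · rw [hg, hD]; simp
      · rfl
    rw [hzero, Matrix.rank_zero, zero_add]
    calc ∑ i ∈ Finset.univ.erase (w 0), (Matrix.of fun g h : Fin (N + 1) → Fin 3 =>
            if g 0 = i then D (w 0) (g 0) (h 0) * X (Fin.tail g) (Fin.tail h) else 0).rank
        ≤ ∑ i ∈ Finset.univ.erase (w 0), X.rank :=
          Finset.sum_le_sum fun i _ => rank_blockRow_le N _ X i
      _ = 2 * X.rank := by
          rw [Finset.sum_const, smul_eq_mul, Finset.card_erase_of_mem (Finset.mem_univ _),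
            Finset.card_univ, Fintype.card_fin]
      _ ≤ 2 ^ (N + 1) := by rw [pow_succ]; omega

/-- Every coordinate slice `T_N(e_w)` of `D^{⊠N}` has rank EXACTLY `2^N`: the single-slice floor of
Part IIb is attained at every coordinate covector. [cite: CoppersmithWinograd1990, §6] -/
theorem rank_slice_single (hD : ∀ a b c, D a b c = if a ≠ b ∧ b ≠ c ∧ a ≠ c then 1 else 0)
    (N : ℕ) (w : Fin N → Fin 3) :
    (contract3 (kroneckerPow D N) (fun v => if v = w then (1 : ℂ) else 0)).rank = 2 ^ N := by
  refine le_antisymm (rank_slice_single_le hD N w) (two_pow_le_rank_slice hD N ?_)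
  intro h
  have := congr_fun h w
  simp at this

/-! ## 4. The pencil constant `3/2` is attained -/

/-- **The pencil law is sharp.**  For every `N` the `3`-space `ℂ³ ⊗ e_{0^N}` of covectors of
`D^{⊠(N+1)}` (free first letter, the other letters frozen at `0`) has ALL slices of rank
`≤ 3·2^N = (3/2)·2^{N+1}` — the constant of `pencil_law` cannot be improved for 3-spaces.
[cite: BlaserIkenmeyerLysikovPandeySchreyer2019, Def. 13] -/
theorem pencil_law_sharp (hD : ∀ a b c, D a b c = if a ≠ b ∧ b ≠ c ∧ a ≠ c then 1 else 0) (N : ℕ) :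
    ∃ U : Submodule ℂ ((Fin (N + 1) → Fin 3) → ℂ), Module.finrank ℂ ↥U = 3 ∧
      ∀ η ∈ U, 2 * (contract3 (kroneckerPow D (N + 1)) η).rank ≤ 3 * 2 ^ (N + 1) := by
  classical
  let w₀ : Fin N → Fin 3 := fun _ => 0
  let L : (Fin 3 → ℂ) →ₗ[ℂ] ((Fin (N + 1) → Fin 3) → ℂ) :=
    { toFun := fun ζ g => ζ (g 0) * (if Fin.tail g = w₀ then 1 else 0)
      map_add' := fun x y => by
        funext g
        by_cases hg : Fin.tail g = w₀ <;> simp [hg]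
      map_smul' := fun s x => by
        funext g
        by_cases hg : Fin.tail g = w₀ <;> simp [hg] }
  have hL : ∀ ζ g, L ζ g = ζ (g 0) * (if Fin.tail g = w₀ then 1 else 0) := fun _ _ => rfl
  have hinj : Function.Injective L := by
    intro x y hxy
    funext d
    have := congr_fun hxy (Fin.cons d w₀)
    simpa [hL, Fin.cons_zero, Fin.tail_cons] using this
  refine ⟨LinearMap.range L, ?_, ?_⟩
  · rw [LinearMap.finrank_range_of_inj hinj, Module.finrank_fintype_fun_eq_card, Fintype.card_fin]
  · rintro _ ⟨ζ, rfl⟩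
    set X := contract3 (kroneckerPow D N) (fun v => if v = w₀ then (1 : ℂ) else 0) with hXd
    have hX : X.rank ≤ 2 ^ N := rank_slice_single_le hD N w₀
    set Dz : Fin 3 → Fin 3 → ℂ := fun i j => ∑ d, ζ d * D d i j with hDz
    have hcomp : ∀ d, (fun v : Fin N → Fin 3 => L ζ (Fin.cons d v)) =
        ζ d • (fun v : Fin N → Fin 3 => if v = w₀ then (1 : ℂ) else 0) := by
      intro d
      funext v
      simp [hL, Fin.cons_zero, Fin.tail_cons]
    have hM : ∀ g h, contract3 (kroneckerPow D (N + 1)) (L ζ) g h =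
        Dz (g 0) (h 0) * X (Fin.tail g) (Fin.tail h) := by
      intro g h
      rw [slice_succ_prod N (L ζ) ζ _ hcomp g h]
    have hbound : (contract3 (kroneckerPow D (N + 1)) (L ζ)).rank ≤ 3 * X.rank := by
      rw [eq_sum_blockRows N Dz X _ hM]
      refine (rank_sum_le _ _).trans ?_
      refine (Finset.sum_le_sum fun i _ => rank_blockRow_le N Dz X i).trans ?_
      rw [Finset.sum_const, smul_eq_mul, Finset.card_univ, Fintype.card_fin]
    rw [pow_succ]
    omega

/-- **The pencil constant of `D^{⊠(N+1)} ≅ cw₂^{⊠(N+1)}` is exactly `3/2`**: every `≥ 3`-dimensional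
space of covectors contains a slice of rank `≥ (3/2)·2^{N+1}` (Part IId), and some `3`-space contains
no slice of larger rank (this file). [cite: BlaserIkenmeyerLysikovPandeySchreyer2019, Def. 13] -/
theorem pencil_constant (hD : ∀ a b c, D a b c = if a ≠ b ∧ b ≠ c ∧ a ≠ c then 1 else 0) (N : ℕ) :
    (∀ U : Submodule ℂ ((Fin (N + 1) → Fin 3) → ℂ), 3 ≤ Module.finrank ℂ ↥U →
        ∃ η ∈ U, 3 * 2 ^ (N + 1) ≤ 2 * (contract3 (kroneckerPow D (N + 1)) η).rank) ∧
      (∃ U : Submodule ℂ ((Fin (N + 1) → Fin 3) → ℂ), Module.finrank ℂ ↥U = 3 ∧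
        ∀ η ∈ U, 2 * (contract3 (kroneckerPow D (N + 1)) η).rank ≤ 3 * 2 ^ (N + 1)) :=
  ⟨fun U hU => pencil_law hD (N + 1) U hU, pencil_law_sharp hD N⟩

end Summit.MatrixMultiplication.MatrixMultiplication.Theorems.OutsiderSandwichPencilSharp
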